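import Summits.CriticalPhenomena.CardyFormulaZ2.Theorems.CardyBoundaryCoulombGasRectilinearCardyStubRowBlocksPart7
import HarnessLib

/-!
# Stub B `stub_rowBlocks` of line `excursion-kernel-covariance`, part 8: the closest-arc rule inside
# the zone of the origin dart, read along the boundary cycle
# (crux `RectilinearCardy`, stmt-CriticalPhenomena-5660, route `CardyBoundaryCoulombGas`)

The end-zone analysis of the ROW BLOCKS stub at the WINDOW: the cycle starts at the origin dart
`e 0 = (X, k₀)` whose successor sits at `v' = X + dir (k₀ + 1)`; the tail arc `A` ends at the foot
`c = ∂D(tv)` of `v'` (inside `B(c, r)` it is the half-line `{-sT (tngC z - tngC c) ≥ 0}`). Since the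
cycle wraps around the period here, the zone splits into the initial stretch (feet near `tX`, indices
`j ≥ 0`) and the final stretch (feet near `tX + 1`, indices `P + j`, `j < 0`); a far dart `e i_far`
with foot in `[tX + 4θ', tX + 1 - 4θ']` separates them.

* `rb_zone_window_result` — the walk's tangential sign is `sT`; `|F 1 - tX| < 2ε₂`;
  `e 1 = (v', k₀)`, `e (P - 1) = (X + dir (k₀ + 3), k₀)`; every dart with foot within `2θ'` of `tX` is a
  row dart attributed to `A` iff its index is `≤ 1`; every dart with foot within `2θ'` of `tX + 1` is a
  row dart attributed to `A`.

All [folklore].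
-/

noncomputable section

open Set Metric
open Literature.Probability.RandomPlanarGeometry
open Literature.Probability.LatticeModels (Site meshPoint Orient)
open Literature.Probability.LatticeModels.CollarLegModel (Dart dartTip dir dsucc outDart period neighbours)

namespace Summit.CriticalPhenomena.CardyFormulaZ2.Cruxes.RectilinearCardy.ExcursionKernelCovariance

/-- **Along the cycle, the attribution to the tail arc inside the window zone.** See the module
docstring; the hypotheses are those of `rb_zone_mark_result` with the origin dart as anchor
(`e 0 = (X, k₀)`, `nrm X = ⌈h/δ⌉`, `X` within `2δ` of `c = ∂D(tv)`, `tngC c = δ (tng X + s)`),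
`tv ∈ [tX, tX + ε₂]`, uniform continuity at scale `3θ'`, and a far dart `e i_far`. [folklore] -/
theorem rb_zone_window_result (D : JordanDomain) {δ η r rz ε₂ m₂ θ θ' tX tv sT h : ℝ}
    {V : Finset (ℤ × ℤ)} {e : ℕ → Dart} {F : ℕ → ℝ} {P N ifar : ℕ} {o : Orient} {k₀ : Fin 4} {s : ℤ}
    {A : Set ℂ} {X : ℤ × ℤ} (hδ : 0 < δ) (hη : 0 < η)
    (hV : ∀ x : ℤ × ℤ, x ∈ V ↔ meshPoint δ (![x.1, x.2] : Site 2) ∈ closure D.carrier)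
    (hP : 0 < P) (hsucc : ∀ n, e (n + 1) = dsucc V (e n)) (hper : ∀ n, e (n + P) = e n)
    (hext : ∀ n, (e n).1 ∈ V ∧ dartTip (e n) ∉ V)
    (hnodup : ∀ n m, n < P → m < P → e n = e m → n = m)
    (hFmono : ∀ n, F n ≤ F (n + 1)) (hFP : ∀ n, F (n + P) = F n + 1)
    (hFclose : ∀ n, dist (D.boundary (F n)) (meshPoint δ (![(e n).1.1, (e n).1.2] : Site 2)) ≤ η)
    (hF0 : |F 0 - tX| < ε₂) (htv : tX ≤ tv ∧ tv ≤ tX + ε₂)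
    (hc : Orient.nrmC o (D.boundary tv) = h)
    (hcl : ∀ z, dist z (D.boundary tv) < r → (z ∈ closure D.carrier ↔ h ≤ Orient.nrmC o z))
    (hop : ∀ z, dist z (D.boundary tv) < r → (z ∈ D.carrier ↔ h < Orient.nrmC o z))
    (htab : ∀ x : ℤ × ℤ,
      Orient.nrm o (![(x + dir k₀).1, (x + dir k₀).2] : Site 2) = Orient.nrm o (![x.1, x.2] : Site 2) - 1 ∧
      Orient.nrm o (![(x + dir (k₀ + 1)).1, (x + dir (k₀ + 1)).2] : Site 2) = Orient.nrm o (![x.1, x.2] : Site 2) ∧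
      Orient.nrm o (![(x + dir (k₀ + 2)).1, (x + dir (k₀ + 2)).2] : Site 2) = Orient.nrm o (![x.1, x.2] : Site 2) + 1 ∧
      Orient.nrm o (![(x + dir (k₀ + 3)).1, (x + dir (k₀ + 3)).2] : Site 2) = Orient.nrm o (![x.1, x.2] : Site 2) ∧
      Orient.tng o (![(x + dir (k₀ + 1)).1, (x + dir (k₀ + 1)).2] : Site 2) = Orient.tng o (![x.1, x.2] : Site 2) + s ∧
      Orient.tng o (![(x + dir (k₀ + 3)).1, (x + dir (k₀ + 3)).2] : Site 2) = Orient.tng o (![x.1, x.2] : Site 2) - s)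
    (hk₀ : ∀ (x : ℤ × ℤ) (k : Fin 4),
      Orient.nrm o (![x.1, x.2] : Site 2) - 1 ≤ Orient.nrm o (![(x + dir k).1, (x + dir k).2] : Site 2) ∧
      (Orient.nrm o (![(x + dir k).1, (x + dir k).2] : Site 2) = Orient.nrm o (![x.1, x.2] : Site 2) - 1 ↔ k = k₀))
    (hs : s = 1 ∨ s = -1) (hsT : sT = 1 ∨ sT = -1) (hrδ : 40 * δ ≤ r)
    (h0 : e 0 = (X, k₀)) (hXn : Orient.nrm o (![X.1, X.2] : Site 2) = ⌈h / δ⌉)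
    (hXdist : dist (meshPoint δ (![X.1, X.2] : Site 2)) (D.boundary tv) < 2 * δ)
    (hXt : Orient.tngC o (D.boundary tv) = δ * ((Orient.tng o (![X.1, X.2] : Site 2) + s : ℤ) : ℝ))
    (hT : ∀ t t' : ℝ, |t - tv| ≤ 2 * θ → |t' - tv| ≤ 2 * θ → t < t' →
      0 < sT * (Orient.tngC o (D.boundary t') - Orient.tngC o (D.boundary t)))
    (hθ : ε₂ ≤ θ' ∧ θ' ≤ θ)
    (hunif : ∀ s t : ℝ, |s - t| ≤ 3 * θ' → dist (D.boundary s) (D.boundary t) < r / 16)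
    (htube : ∀ s t : ℝ, (∀ n : ℤ, ε₂ ≤ |s - t - n|) → m₂ ≤ dist (D.boundary s) (D.boundary t))
    (hrz : rz + η < m₂) (hN1 : 3 * η ≤ N * δ) (hN2 : (N + 4) * δ ≤ rz) (hrzr : rz ≤ r / 8)
    (hifar : ifar < P) (hFfar : tX + 4 * θ' ≤ F ifar ∧ F ifar ≤ tX + 1 - 4 * θ')
    (hfar : r / 2 ≤ dist (meshPoint δ (![(e ifar).1.1, (e ifar).1.2] : Site 2)) (D.boundary tv))
    (hAf : A ⊆ frontier D.carrier) (hAne : A.Nonempty) (hCne : (frontier D.carrier \ A).Nonempty)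
    (hAend : ∀ z ∈ frontier D.carrier, dist z (D.boundary tv) < r →
      (z ∈ A ↔ 0 ≤ -sT * (Orient.tngC o z - Orient.tngC o (D.boundary tv)))) :
    (s : ℝ) = sT ∧ |F 1 - tX| < 2 * ε₂ ∧ e 1 = (X + dir (k₀ + 1), k₀) ∧ e (P - 1) = (X + dir (k₀ + 3), k₀) ∧
      6 < P ∧
      (∀ i < P, |F i - tX| < 2 * θ' →
        ((neighbours (e i).1).filter (fun y ↦ y ∉ V)).card = 1 ∧ (e i).2 = k₀ ∧
        Orient.nrm o (![(e i).1.1, (e i).1.2] : Site 2) = ⌈h / δ⌉ ∧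
        (infDist (meshPoint δ (![(e i).1.1, (e i).1.2] : Site 2)) A ≤
            infDist (meshPoint δ (![(e i).1.1, (e i).1.2] : Site 2)) (frontier D.carrier \ A) ↔ i ≤ 1)) ∧
      (∀ i < P, |F i - (tX + 1)| < 2 * θ' →
        ((neighbours (e i).1).filter (fun y ↦ y ∉ V)).card = 1 ∧ (e i).2 = k₀ ∧
        Orient.nrm o (![(e i).1.1, (e i).1.2] : Site 2) = ⌈h / δ⌉ ∧
        infDist (meshPoint δ (![(e i).1.1, (e i).1.2] : Site 2)) A ≤
          infDist (meshPoint δ (![(e i).1.1, (e i).1.2] : Site 2)) (frontier D.carrier \ A)) := by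
  have hε₂ : 0 < ε₂ := lt_of_le_of_lt (abs_nonneg _) hF0
  have hr : 0 < r := by linarith
  have hmono : Monotone F := monotone_nat_of_le_succ hFmono
  obtain ⟨hm1, hm2⟩ := kwl_ceil_bounds (h := h) hδ
  have hs2 : (s : ℝ) * s = 1 := by rcases hs with rfl | rfl <;> norm_num
  -- the run through the window zone
  obtain ⟨h2n, hfwd, hbwd, hcap⟩ :=
    rb_zone_window hδ hV hP hsucc hper hext hnodup hcl htab hk₀ hs hrδ h0 hXn hXdist
  set n : ℕ := ⌊r / (4 * δ)⌋₊ + 3 with hn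
  have hnδ : (n : ℝ) * δ ≤ r / 4 + 3 * δ := by
    have h1 : (⌊r / (4 * δ)⌋₊ : ℝ) ≤ r / (4 * δ) := Nat.floor_le (by positivity)
    have h2 : (n : ℝ) = ⌊r / (4 * δ)⌋₊ + 3 := by rw [hn]; push_cast; ring
    rw [h2, add_mul]
    have h3 : (⌊r / (4 * δ)⌋₊ : ℝ) * δ ≤ r / (4 * δ) * δ := mul_le_mul_of_nonneg_right h1 hδ.le
    rw [div_mul_eq_mul_div, mul_div_mul_right _ _ hδ.ne'] at h3
    linarith
  have hFtop : ∀ i ≤ P, F i ≤ F 0 + 1 := fun i hi => by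
    have := hFP 0
    rw [zero_add] at this
    rw [← this]; exact hmono hi
  -- localisation of feet by the tube lemma: near `tv` or near `tv + 1`
  have hloc : ∀ i ≤ P, dist (meshPoint δ (![(e i).1.1, (e i).1.2] : Site 2)) (D.boundary tv) < rz →
      |F i - tv| < ε₂ ∨ |F i - tv - 1| < ε₂ := by
    intro i hi hd
    obtain ⟨k, hk⟩ := rb_foot_window D htube (hFclose i) hd.le (by linarith)
    have hlo : F 0 ≤ F i := hmono (Nat.zero_le i)
    have hhi := hFtop i hi
    have hF0' := hF0
    rw [abs_lt] at hF0' hk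
    have hk3 : k ≤ -1 ∨ k = 0 ∨ k = 1 ∨ 2 ≤ k := by omega
    rcases hk3 with hk' | hk' | hk' | hk'
    · have : (k : ℝ) ≤ -1 := by exact_mod_cast hk'
      exfalso; linarith [hFfar.1, hFfar.2, hθ.1]
    · left; rw [hk', Int.cast_zero, sub_zero] at hk; exact abs_lt.2 hk
    · right; rw [hk', Int.cast_one] at hk; exact abs_lt.2 hk
    · have : (2 : ℝ) ≤ k := by exact_mod_cast hk'
      exfalso; linarith [hFfar.1, hFfar.2, hθ.1]
  -- the far dart is outside both runs
  have hfar_lt : n < ifar := by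
    by_contra hge
    rw [not_lt] at hge
    have h1 := hfwd ifar hge
    have h2 := rb_dist_mesh_nsmul_le hδ X (k₀ + 1) ifar
    have h3 := dist_triangle (meshPoint δ (![(X + ifar • dir (k₀ + 1)).1, (X + ifar • dir (k₀ + 1)).2] : Site 2))
      (meshPoint δ (![X.1, X.2] : Site 2)) (D.boundary tv)
    rw [← show (e ifar).1 = X + ifar • dir (k₀ + 1) by rw [h1]] at h2 h3
    have h4 : (ifar : ℝ) * δ ≤ n * δ := mul_le_mul_of_nonneg_right (by exact_mod_cast hge) hδ.le
    linarith
  have hfar_gt : ifar < P - n := by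
    by_contra hge
    rw [not_lt] at hge
    have hj : P - ifar ≤ n := by omega
    have h1 := hbwd (P - ifar) hj
    rw [show P - (P - ifar) = ifar by omega] at h1
    have h2 := rb_dist_mesh_nsmul_le hδ X (k₀ + 3) (P - ifar)
    have h3 := dist_triangle
      (meshPoint δ (![(X + (P - ifar) • dir (k₀ + 3)).1, (X + (P - ifar) • dir (k₀ + 3)).2] : Site 2))
      (meshPoint δ (![X.1, X.2] : Site 2)) (D.boundary tv)
    rw [← show (e ifar).1 = X + (P - ifar) • dir (k₀ + 3) by rw [h1]] at h2 h3
    have h4 : ((P - ifar : ℕ) : ℝ) * δ ≤ n * δ := mul_le_mul_of_nonneg_right (by exact_mod_cast hj) hδ.le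
    linarith
  -- feet of darts marched forward from `X` stay near `tv` (they come before the far dart)
  have hfwd_near : ∀ j ≤ n, dist (meshPoint δ (![(e j).1.1, (e j).1.2] : Site 2)) (D.boundary tv) < rz →
      |F j - tv| < ε₂ := by
    intro j hj hd
    rcases hloc j (by omega) hd with h | h
    · exact h
    · exfalso
      have h1 : F j ≤ F ifar := hmono (by omega)
      rw [abs_lt] at h
      linarith [hFfar.2, hθ.1]
  -- the dart at `v'`
  have he1 : e 1 = (X + dir (k₀ + 1), k₀) := by have := hfwd 1 (by omega); rwa [one_nsmul] at this
  have hd1 : dist (meshPoint δ (![(e 1).1.1, (e 1).1.2] : Site 2)) (D.boundary tv) < rz := by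
    rw [he1]
    have h1 := Orient.norm_le_abs_tngC_add_abs_nrmC o
      (meshPoint δ (![(X + dir (k₀ + 1)).1, (X + dir (k₀ + 1)).2] : Site 2) - D.boundary tv)
    rw [Orient.tngC_sub, Orient.nrmC_sub, Orient.tngC_meshPoint, Orient.nrmC_meshPoint, (htab X).2.2.2.2.1,
      (htab X).2.1, hXn, hc, hXt, sub_self, abs_zero, zero_add] at h1
    rw [dist_eq_norm]
    have h2 : |δ * (⌈h / δ⌉ : ℝ) - h| < δ := by rw [abs_lt]; constructor <;> linarith
    linarith
  have hF1 : |F 1 - tX| < 2 * ε₂ := by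
    have := hfwd_near 1 (by omega) hd1
    rw [abs_lt] at this ⊢; constructor <;> linarith [htv.1, htv.2]
  -- the direction of the walk
  have hNn : N ≤ n := by
    have hNe : ((N : ℝ) + 4) * δ = N * δ + 4 * δ := by ring
    have h1 : (N : ℝ) * δ ≤ r / 8 := by linarith
    have h2 : (N : ℝ) ≤ r / (4 * δ) := by
      rw [le_div_iff₀ (by positivity)]
      have : (N : ℝ) * (4 * δ) = 4 * (N * δ) := by ring
      linarith
    have h3 := Nat.lt_floor_add_one (r / (4 * δ))
    have h4 : (N : ℝ) < (n : ℝ) := by rw [hn]; push_cast; linarith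
    exact_mod_cast h4.le
  have heN : e N = (X + N • dir (k₀ + 1), k₀) := hfwd N hNn
  have htngN : Orient.tng o (![(e (0 + N)).1.1, (e (0 + N)).1.2] : Site 2) =
      Orient.tng o (![(e 0).1.1, (e 0).1.2] : Site 2) + N * s := by
    rw [Nat.zero_add, heN, h0, rb_nsmul_eq_zsmul, (rb_zsmul_coords htab X _).2]
  have hdN : dist (meshPoint δ (![(e N).1.1, (e N).1.2] : Site 2)) (D.boundary tv) < rz := by
    rw [heN]
    have h1 := rb_dist_mesh_nsmul_le hδ X (k₀ + 1) N
    have h2 := dist_triangle (meshPoint δ (![(X + N • dir (k₀ + 1)).1, (X + N • dir (k₀ + 1)).2] : Site 2))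
      (meshPoint δ (![X.1, X.2] : Site 2)) (D.boundary tv)
    have hNe : ((N : ℝ) + 4) * δ = N * δ + 4 * δ := by ring
    linarith
  have hFN : |F N - tv| < ε₂ := hfwd_near N hNn hdN
  have hdir : (s : ℝ) = sT := by
    refine rb_direction D (iZ := 0) hδ hη hFmono hFclose hs hsT hT ?_ ?_ htngN hN1
    · rw [abs_lt] at hF0; rw [abs_le]; constructor <;> linarith [htv.1, htv.2]
    · rw [Nat.zero_add]; linarith [hFN.le]
  -- preparations for the closest-arc rule at a captured dart
  have hsσ : -sT = 1 ∨ -sT = -1 := by rcases hsT with rfl | rfl <;> norm_num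
  have hcrit : ∀ i < P, dist (meshPoint δ (![(e i).1.1, (e i).1.2] : Site 2)) (D.boundary tv) < r / 4 →
      ∀ j : ℤ, Orient.tng o (![(e i).1.1, (e i).1.2] : Site 2) = Orient.tng o (![X.1, X.2] : Site 2) + j * s →
      Orient.nrm o (![(e i).1.1, (e i).1.2] : Site 2) = ⌈h / δ⌉ →
      (infDist (meshPoint δ (![(e i).1.1, (e i).1.2] : Site 2)) A ≤
          infDist (meshPoint δ (![(e i).1.1, (e i).1.2] : Site 2)) (frontier D.carrier \ A) ↔ j ≤ 1) := by
    intro i _ hdi j htng hrow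
    have hp0 : h ≤ Orient.nrmC o (meshPoint δ (![(e i).1.1, (e i).1.2] : Site 2)) :=
      (hcl _ (by linarith)).1 ((hV _).1 (hext i).1)
    have hp1 : Orient.nrmC o (meshPoint δ (![(e i).1.1, (e i).1.2] : Site 2)) - h < r / 4 := by
      rw [Orient.nrmC_meshPoint, hrow]; linarith
    obtain ⟨hcrit1, hcrit2⟩ := rb_zone_criterion (A := A) (s := -sT)
      (p := meshPoint δ (![(e i).1.1, (e i).1.2] : Site 2)) D.isOpen hcl hop hAf hAne hCne hsσ hAend hdi hp0 hp1
    have hQ : -sT * (Orient.tngC o (meshPoint δ (![(e i).1.1, (e i).1.2] : Site 2)) - Orient.tngC o (D.boundary tv)) =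
        δ * (1 - j) := by
      rw [Orient.tngC_meshPoint, htng, hXt, ← hdir]; push_cast; linear_combination (-(δ * (j - 1))) * hs2
    rw [hQ] at hcrit1 hcrit2
    constructor
    · intro hattr
      by_contra hneg
      rw [not_le] at hneg
      have hneg' : (1 : ℝ) - j ≤ -1 := by
        have : 1 - j ≤ -1 := by omega
        exact_mod_cast this
      have h5 : δ * (1 - (j : ℝ)) ≤ δ * (-1) := mul_le_mul_of_nonneg_left hneg' hδ.le
      have h7 : δ * (1 - (j : ℝ)) < 0 := by linarith
      exact absurd hattr (not_le.2 (hcrit2 h7))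
    · intro hj
      have hj' : (0 : ℝ) ≤ 1 - j := by
        have : (0 : ℤ) ≤ 1 - j := by omega
        exact_mod_cast this
      exact hcrit1 (mul_nonneg hδ.le hj')
  refine ⟨hdir, hF1, he1, by have := hbwd 1 (by omega); rwa [one_nsmul] at this, by omega,
    fun i hi hFi => ?_, fun i hi hFi => ?_⟩
  · -- feet near `tX`: the initial stretch
    have hdi : dist (meshPoint δ (![(e i).1.1, (e i).1.2] : Site 2)) (D.boundary tv) < r / 4 := by
      have h1 : dist (D.boundary (F i)) (D.boundary tv) < r / 16 := by
        refine hunif (F i) tv ?_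
        rw [abs_lt] at hFi; rw [abs_le]; constructor <;> linarith [htv.1, htv.2, hθ.1]
      have h2 := dist_triangle (meshPoint δ (![(e i).1.1, (e i).1.2] : Site 2)) (D.boundary (F i)) (D.boundary tv)
      have h3 : dist (meshPoint δ (![(e i).1.1, (e i).1.2] : Site 2)) (D.boundary (F i)) ≤ η := by
        rw [dist_comm]; exact hFclose i
      linarith
    obtain ⟨hrow, hdr, hcard, j, hjn, htng, hij⟩ := hcap i hi hdi
    refine ⟨hcard, hdr, hrow, ?_⟩
    rw [hcrit i hi hdi j htng hrow]
    rcases hij with ⟨hj0, hij⟩ | ⟨hj0, hij⟩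
    · omega
    · -- a dart of the final stretch cannot have its foot near `tX`
      exfalso
      have h1 : ifar ≤ i := by
        have : (P : ℤ) - n ≤ i := by
          have := (abs_le.1 (show |j| ≤ (n : ℤ) by exact_mod_cast hjn)).1; omega
        omega
      have h2 : F ifar ≤ F i := hmono h1
      rw [abs_lt] at hFi
      linarith [hFfar.1]
  · -- feet near `tX + 1`: the final stretch
    have hdi : dist (meshPoint δ (![(e i).1.1, (e i).1.2] : Site 2)) (D.boundary tv) < r / 4 := by
      have h1 : dist (D.boundary (F i)) (D.boundary tv) < r / 16 := by
        have hper' := D.periodic_boundary.sub_int_mul_eq 1 (x := F i)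
        rw [Int.cast_one, mul_one] at hper'
        rw [← hper']
        refine hunif (F i - 1) tv ?_
        rw [abs_lt] at hFi; rw [abs_le]; constructor <;> linarith [htv.1, htv.2, hθ.1]
      have h2 := dist_triangle (meshPoint δ (![(e i).1.1, (e i).1.2] : Site 2)) (D.boundary (F i)) (D.boundary tv)
      have h3 : dist (meshPoint δ (![(e i).1.1, (e i).1.2] : Site 2)) (D.boundary (F i)) ≤ η := by
        rw [dist_comm]; exact hFclose i
      linarith
    obtain ⟨hrow, hdr, hcard, j, hjn, htng, hij⟩ := hcap i hi hdi
    refine ⟨hcard, hdr, hrow, ?_⟩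
    rw [hcrit i hi hdi j htng hrow]
    rcases hij with ⟨hj0, hij⟩ | ⟨hj0, hij⟩
    · -- a dart of the initial stretch cannot have its foot near `tX + 1`
      exfalso
      have h1 : i ≤ ifar := by
        have : (i : ℤ) ≤ n := by
          have := (abs_le.1 (show |j| ≤ (n : ℤ) by exact_mod_cast hjn)).2; omega
        omega
      have h2 : F i ≤ F ifar := hmono h1
      rw [abs_lt] at hFi
      linarith [hFfar.2]
    · omega

end Summit.CriticalPhenomena.CardyFormulaZ2.Cruxes.RectilinearCardy.ExcursionKernelCovariance

end
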